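import Literature.AlgebraicGeometry.HodgeTheory.CyclicCoverFibreScaling
import Literature.AlgebraicGeometry.HodgeTheory.CyclicCoverBaseChart
import Literature.AlgebraicGeometry.Motives.UniversalHypersurfaceRegularLocusEquation
import Literature.AlgebraicGeometry.Motives.UniversalHypersurfaceRegularLocusTopology
import HarnessLib

/-!
# The fibres of the Carlson–Toledo family as subsets of the regular locus of the universal quaternary family

Family `hodge`, layer `Literature/AlgebraicGeometry/HodgeTheory`; step A5a of the programme discharging
`carlsonToledo1999_nodalMeridianLocalMonodromyBound` (crux K1 of
`Summits/HodgeConjecture/HodgeConjecture/Theses/CyclicUnitaryPowers.lean`). The geometric monodromy of the nodal pencil is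
built on the regular locus `𝒴°(ℂ)` of the universal family of quaternary `p`-forms (`regularTotal ℂ 2 p`), while the
transport to be identified lives in the universal family `u = cyclicCoverFamily p : 𝒴 → S` of smooth cyclic covers. This file
reads the fibres `X_t(ℂ)` of `u` inside `𝒴°(ℂ)`:

* `regOfCyc p` — the map `𝒴(ℂ) → 𝒴°(ℂ)` induced by `𝒴 = 𝒴_U ×_U S → 𝒴_U ↪ 𝒴°`; continuous; it preserves the homogeneous
  coordinates (`hypersurfacePoint_regOfCyc`) and reads the coefficient vector of the base point
  (`regCoeff_regOfCyc : b(regOfCyc P) = coeffVector [x₃^p − f_{u(P)}]`);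
* `cycFibreToReg p t : C(X_t(ℂ), 𝒴°(ℂ))` — its restriction to a fibre: injective, a CLOSED EMBEDDING (compact source,
  Hausdorff target) with range **exactly the member `{Q ∈ 𝒴°(ℂ) | b(Q) = coeffVector [x₃^p − f_t]}`** (`range_cycFibreToReg`:
  every point of `𝒴°(ℂ)` with that coefficient vector has coordinates on `V(x₃^p − f_t)` by the universal equation, hence comes
  from a point of `𝒴(ℂ)` over `t`, and points of `𝒴°(ℂ)` are determined by `(b, [z])`);
* `cycFibreHomeo p t : X_t(ℂ) ≃ₜ {Q | b(Q) = coeffVector [x₃^p − f_t]}` — the resulting homeomorphism, with its two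
  evaluation lemmas;
* `continuous_map_fiberι_cycFibreHomeo_symm` — **joint continuity of the inverse in families**: for continuous
  `t : A → S(ℂ)` and `f : A → 𝒴°(ℂ)` with `b(f a) = coeffVector [x₃^p − f_{t a}]`, the map
  `a ↦ ι_{t a}((cycFibreHomeo (t a))⁻¹ (f a)) ∈ 𝒴(ℂ)` is continuous (through the closed embedding
  `([z], u) : 𝒴(ℂ) ↪ ℙ(ℂ⁴) × S(ℂ)` of `CyclicCoverTotalSpacePoints`) — the input `hcont` of `DirectImageIsotopy` for fibre
  maps defined through `𝒴°(ℂ)`.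

Everything is proved; the three definitions are concrete; no named facts.

## References

* [CarlsonToledo1999] J. A. Carlson, D. Toledo, Duke Math. J. 97 (1999), §2 (universalcyclic) (held text p0004–p0005).
* [VoisinHodgeII2003] C. Voisin, Hodge Theory and Complex Algebraic Geometry II, §6.2.1.
* [SerreGAGA1956] J.-P. Serre, GAGA, §2 n°5.
-/

noncomputable section

namespace Literature.AlgebraicGeometry.HodgeTheory

open CategoryTheory _root_.AlgebraicGeometry _root_.Topology MvPolynomial
open Literature.AlgebraicGeometry.Motives Literature.AlgebraicGeometry.Motives.UniversalHypersurface
open Literature.AlgebraicGeometry.HodgeTheory.UniversalHypersurface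

section FibreEmbedding

variable (p : ℕ)

/-! ### `𝒴(ℂ) → 𝒴°(ℂ)` -/

/-- **The cyclic total space read in the regular locus**: `𝒴(ℂ) → 𝒴_U(ℂ) → 𝒴°(ℂ)`.
[cite: CarlsonToledo1999, §2 (universalcyclic) (held text p0004)] [cite: VoisinHodgeII2003, §6.2.1] -/
def regOfCyc : ComplexPoints (cyclicCoverTotal p) → ComplexPoints (regularTotal ℂ 2 p) :=
  AlgPoints.map (totalSpzToTotal ℂ 2 p (cyclicCoverSpz p) ≫ totalToRegular ℂ 2 p)

/-- `regOfCyc` is continuous. [cite: SerreGAGA1956, §2 n°5] -/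
theorem continuous_regOfCyc : Continuous (regOfCyc p) :=
  AlgPoints.continuous_map _

/-- **`regOfCyc` preserves the homogeneous coordinates.** [cite: CarlsonToledo1999, §2 (universalcyclic) (held text p0004)] -/
theorem hypersurfacePoint_regOfCyc (P : ComplexPoints (cyclicCoverTotal p)) :
    hypersurfacePoint (regularToProjectiveSpace ℂ 2 p) (regOfCyc p P) =
      hypersurfacePoint (totalSpzToTotal ℂ 2 p (cyclicCoverSpz p) ≫ UniversalHypersurface.toProjectiveSpace ℂ 2 p) P := by
  rw [regOfCyc, ← hypersurfacePoint_comp, Category.assoc, totalToRegular_comp_regularToProjectiveSpace]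

/-- **The coefficient vector of `regOfCyc P` is that of the form `x₃^p − f_{u(P)}` of its base point.**
[cite: CarlsonToledo1999, §2 (universalcyclic) (held text p0004)] [cite: VoisinHodgeII2003, §6.2.1] -/
theorem regCoeff_regOfCyc (P : ComplexPoints (cyclicCoverTotal p)) :
    regCoeff ℂ 2 p (regOfCyc p P) =
      coeffVector ℂ 2 p (AlgPoints.map (toBaseSpz ℂ 2 p (cyclicCoverSpz p)) (AlgPoints.map (cyclicCoverFamily p) P)) := by
  rw [regOfCyc, AlgPoints.map_comp_apply, regCoeff_map_totalToRegular, ← AlgPoints.map_comp_apply,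
    totalSpzToTotal_comp_family, AlgPoints.map_comp_apply]

/-- The form of `regOfCyc P` is `x₃^p − f_{u(P)}`. [cite: CarlsonToledo1999, §2 (universalcyclic) (held text p0004)] -/
theorem regForm_regOfCyc (P : ComplexPoints (cyclicCoverTotal p)) :
    regForm ℂ 2 p (regOfCyc p P) = pointFormSpz ℂ 2 p (cyclicCoverSpz p) (AlgPoints.map (cyclicCoverFamily p) P) := by
  rw [regForm_eq_formOfCoeffs, regCoeff_regOfCyc, formOfCoeffs_coeffVector]

/-! ### The fibre `X_t(ℂ)` inside `𝒴°(ℂ)` -/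

/-- **The fibre `X_t(ℂ)` read in the regular locus**: `X_t(ℂ) → 𝒴(ℂ) → 𝒴°(ℂ)`.
[cite: CarlsonToledo1999, §2 (universalcyclic) (held text p0004)] -/
def cycFibreToReg (t : ComplexPoints (cyclicCoverBase p)) :
    C(ComplexPoints (fiberOver (cyclicCoverFamily p) t), ComplexPoints (regularTotal ℂ 2 p)) :=
  ⟨fun y => regOfCyc p (AlgPoints.map (fiberι (cyclicCoverFamily p) t) y),
    (continuous_regOfCyc p).comp (AlgPoints.continuous_map _)⟩

/-- Unfolding `cycFibreToReg`. [cite: CarlsonToledo1999, §2 (universalcyclic) (held text p0004)] -/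
theorem cycFibreToReg_apply (t : ComplexPoints (cyclicCoverBase p)) (y : ComplexPoints (fiberOver (cyclicCoverFamily p) t)) :
    cycFibreToReg p t y = regOfCyc p (AlgPoints.map (fiberι (cyclicCoverFamily p) t) y) := rfl

/-- **The coefficient vector is constant on the fibre**: `b(ι_t y) = coeffVector [x₃^p − f_t]`.
[cite: CarlsonToledo1999, §2 (universalcyclic) (held text p0004)] -/
theorem regCoeff_cycFibreToReg (t : ComplexPoints (cyclicCoverBase p)) (y : ComplexPoints (fiberOver (cyclicCoverFamily p) t)) :
    regCoeff ℂ 2 p (cycFibreToReg p t y) = coeffVector ℂ 2 p (AlgPoints.map (toBaseSpz ℂ 2 p (cyclicCoverSpz p)) t) := by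
  rw [cycFibreToReg_apply, regCoeff_regOfCyc, AlgPoints.map_map_fiberι]

/-- The homogeneous coordinates of `ι_t y` are the coordinates of `y` in `𝒴(ℂ)`. [cite: CarlsonToledo1999, §2 (held text p0004)] -/
theorem hypersurfacePoint_cycFibreToReg (t : ComplexPoints (cyclicCoverBase p))
    (y : ComplexPoints (fiberOver (cyclicCoverFamily p) t)) :
    hypersurfacePoint (regularToProjectiveSpace ℂ 2 p) (cycFibreToReg p t y) =
      hypersurfacePoint (totalSpzToTotal ℂ 2 p (cyclicCoverSpz p) ≫ UniversalHypersurface.toProjectiveSpace ℂ 2 p)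
        (AlgPoints.map (fiberι (cyclicCoverFamily p) t) y) := by
  rw [cycFibreToReg_apply, hypersurfacePoint_regOfCyc]

variable [NeZero p]

/-- **`ι_t : X_t(ℂ) → 𝒴°(ℂ)` is injective** (points of the fibre are determined by their coordinates).
[cite: SerreGAGA1956, §2 n°5 Lemme 1 b)] -/
theorem cycFibreToReg_injective (t : ComplexPoints (cyclicCoverBase p)) : Function.Injective (cycFibreToReg p t) := by
  intro y y' h
  apply eq_of_coords_map_fiberι_eq
  rw [← hypersurfacePoint_cycFibreToReg, ← hypersurfacePoint_cycFibreToReg, h]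

/-- `X_t(ℂ)` is compact. [cite: SerreGAGA1956, §2 n°7 Prop. 6] -/
theorem compactSpace_cycFibre (t : ComplexPoints (cyclicCoverBase p)) :
    CompactSpace (ComplexPoints (fiberOver (cyclicCoverFamily p) t)) := by
  haveI : IsProper (cyclicCoverFamily p).left := isProper_cyclicCoverFamily_left
  haveI : IsProper (fiberOver (cyclicCoverFamily p) t).hom := isProper_fiberOver_hom (cyclicCoverFamily p) t
  exact compactSpace_algPoints_of_isProper_holds _ ℂ

/-- **`ι_t` is a closed embedding** (continuous injective from a compact space to a Hausdorff one; `p ≥ 1`).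
[cite: SerreGAGA1956, §2 n°5] -/
theorem isClosedEmbedding_cycFibreToReg (t : ComplexPoints (cyclicCoverBase p)) : IsClosedEmbedding (cycFibreToReg p t) := by
  haveI := compactSpace_cycFibre p t
  haveI : T2Space (ComplexPoints (regularTotal ℂ 2 p)) := t2Space_regularTotal 2 p
  exact (cycFibreToReg p t).continuous.isClosedEmbedding (cycFibreToReg_injective p t)

/-- **The range of `ι_t` is the member `{b = coeffVector [x₃^p − f_t]}` of `𝒴°(ℂ)`.**
[cite: CarlsonToledo1999, §2 (universalcyclic) (held text p0004)] [cite: VoisinHodgeII2003, §6.2.1] -/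
theorem range_cycFibreToReg (t : ComplexPoints (cyclicCoverBase p)) :
    Set.range (cycFibreToReg p t) =
      {Q | regCoeff ℂ 2 p Q = coeffVector ℂ 2 p (AlgPoints.map (toBaseSpz ℂ 2 p (cyclicCoverSpz p)) t)} := by
  ext Q
  constructor
  · rintro ⟨y, rfl⟩
    exact regCoeff_cycFibreToReg p t y
  · intro hQ
    -- the coordinates of `Q` lie on `V(x₃^p − f_t)`
    have hform : regForm ℂ 2 p Q = pointFormSpz ℂ 2 p (cyclicCoverSpz p) t := by
      rw [regForm_eq_formOfCoeffs, Set.mem_setOf_eq.mp hQ, formOfCoeffs_coeffVector]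
    have hmem : hypersurfacePoint (regularToProjectiveSpace ℂ 2 p) Q ∈
        Projectivization.projZeroLocus {pointFormSpz ℂ 2 p (cyclicCoverSpz p) t} := by
      rw [← hform]; exact hypersurfacePoint_mem_projZeroLocus_regForm 2 p Q
    obtain ⟨P, hPt, hPz⟩ := exists_point_of_mem_projZeroLocus p t hmem
    obtain ⟨y, rfl⟩ : P ∈ Set.range (AlgPoints.map (fiberι (cyclicCoverFamily p) t)) := by
      rw [AlgPoints.range_map_fiberι]; exact hPt
    refine ⟨y, eq_of_hypersurfacePoint_eq_of_regCoeff_eq 2 p ?_ ?_⟩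
    · rw [hypersurfacePoint_cycFibreToReg, hPz]
    · rw [regCoeff_cycFibreToReg, Set.mem_setOf_eq.mp hQ]

/-- **The fibre `X_t(ℂ)` is homeomorphic to the member `{b = coeffVector [x₃^p − f_t]}` of `𝒴°(ℂ)`.**
[cite: CarlsonToledo1999, §2 (universalcyclic) (held text p0004)] [cite: SerreGAGA1956, §2 n°5] -/
def cycFibreHomeo (t : ComplexPoints (cyclicCoverBase p)) :
    ComplexPoints (fiberOver (cyclicCoverFamily p) t) ≃ₜ
      {Q : ComplexPoints (regularTotal ℂ 2 p) |
        regCoeff ℂ 2 p Q = coeffVector ℂ 2 p (AlgPoints.map (toBaseSpz ℂ 2 p (cyclicCoverSpz p)) t)} :=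
  (isClosedEmbedding_cycFibreToReg p t).isEmbedding.toHomeomorph.trans (Homeomorph.setCongr (range_cycFibreToReg p t))

/-- `cycFibreHomeo` is `ι_t` on underlying points. [cite: CarlsonToledo1999, §2 (held text p0004)] -/
@[simp]
theorem coe_cycFibreHomeo_apply (t : ComplexPoints (cyclicCoverBase p)) (y : ComplexPoints (fiberOver (cyclicCoverFamily p) t)) :
    ((cycFibreHomeo p t y : {Q : ComplexPoints (regularTotal ℂ 2 p) |
        regCoeff ℂ 2 p Q = coeffVector ℂ 2 p (AlgPoints.map (toBaseSpz ℂ 2 p (cyclicCoverSpz p)) t)}) :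
      ComplexPoints (regularTotal ℂ 2 p)) = cycFibreToReg p t y :=
  rfl

/-- `ι_t ((cycFibreHomeo t)⁻¹ Q) = Q`. [cite: CarlsonToledo1999, §2 (held text p0004)] -/
theorem cycFibreToReg_symm_apply (t : ComplexPoints (cyclicCoverBase p))
    (Q : {Q : ComplexPoints (regularTotal ℂ 2 p) |
      regCoeff ℂ 2 p Q = coeffVector ℂ 2 p (AlgPoints.map (toBaseSpz ℂ 2 p (cyclicCoverSpz p)) t)}) :
    cycFibreToReg p t ((cycFibreHomeo p t).symm Q) = Q.1 := by
  conv_rhs => rw [← (cycFibreHomeo p t).apply_symm_apply Q]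
  rfl

/-- `(cycFibreHomeo t)⁻¹ (ι_t y) = y`. [cite: CarlsonToledo1999, §2 (held text p0004)] -/
theorem cycFibreHomeo_symm_apply_mk (t : ComplexPoints (cyclicCoverBase p)) (y : ComplexPoints (fiberOver (cyclicCoverFamily p) t))
    (h : cycFibreToReg p t y ∈ {Q : ComplexPoints (regularTotal ℂ 2 p) |
      regCoeff ℂ 2 p Q = coeffVector ℂ 2 p (AlgPoints.map (toBaseSpz ℂ 2 p (cyclicCoverSpz p)) t)}) :
    (cycFibreHomeo p t).symm ⟨cycFibreToReg p t y, h⟩ = y :=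
  cycFibreToReg_injective p t (by rw [cycFibreToReg_symm_apply])

/-- **Coordinates and base point of the lifted point**: for `Q` in the member over `t`,
`([z], u)(ι_t-lift of Q) = ([z](Q), t)`. [cite: CarlsonToledo1999, §2 (held text p0004)] -/
theorem coords_map_fiberι_cycFibreHomeo_symm (t : ComplexPoints (cyclicCoverBase p))
    (Q : {Q : ComplexPoints (regularTotal ℂ 2 p) |
      regCoeff ℂ 2 p Q = coeffVector ℂ 2 p (AlgPoints.map (toBaseSpz ℂ 2 p (cyclicCoverSpz p)) t)}) :
    (hypersurfacePoint (totalSpzToTotal ℂ 2 p (cyclicCoverSpz p) ≫ UniversalHypersurface.toProjectiveSpace ℂ 2 p)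
        (AlgPoints.map (fiberι (cyclicCoverFamily p) t) ((cycFibreHomeo p t).symm Q)),
      AlgPoints.map (cyclicCoverFamily p) (AlgPoints.map (fiberι (cyclicCoverFamily p) t) ((cycFibreHomeo p t).symm Q))) =
      (hypersurfacePoint (regularToProjectiveSpace ℂ 2 p) Q.1, t) := by
  rw [AlgPoints.map_map_fiberι, ← hypersurfacePoint_cycFibreToReg, cycFibreToReg_symm_apply]

/-- **Joint continuity of the inverse in families.** For continuous `t : A → S(ℂ)` and `f : A → 𝒴°(ℂ)` with
`b(f a) = coeffVector [x₃^p − f_{t a}]`, the map `a ↦ ι_{t a}((cycFibreHomeo (t a))⁻¹ (f a))` into `𝒴(ℂ)` is continuous: composed with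
the closed embedding `([z], u)` it is `a ↦ ([z](f a), t a)`. [cite: CarlsonToledo1999, §2 (universalcyclic) (held text p0004–p0005)]
[cite: SerreGAGA1956, §2 n°5 Lemme 1 b)] -/
theorem continuous_map_fiberι_cycFibreHomeo_symm {A : Type*} [TopologicalSpace A]
    (t : A → ComplexPoints (cyclicCoverBase p)) (ht : Continuous t)
    (f : A → ComplexPoints (regularTotal ℂ 2 p)) (hf : Continuous f)
    (hft : ∀ a, regCoeff ℂ 2 p (f a) = coeffVector ℂ 2 p (AlgPoints.map (toBaseSpz ℂ 2 p (cyclicCoverSpz p)) (t a))) :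
    Continuous fun a => AlgPoints.map (fiberι (cyclicCoverFamily p) (t a)) ((cycFibreHomeo p (t a)).symm ⟨f a, hft a⟩) := by
  rw [(isClosedEmbedding_coords_prod_map p).isEmbedding.isInducing.continuous_iff]
  have h : ((fun P : ComplexPoints (cyclicCoverTotal p) =>
      (hypersurfacePoint (totalSpzToTotal ℂ 2 p (cyclicCoverSpz p) ≫ UniversalHypersurface.toProjectiveSpace ℂ 2 p) P,
        AlgPoints.map (cyclicCoverFamily p) P)) ∘
      fun a => AlgPoints.map (fiberι (cyclicCoverFamily p) (t a)) ((cycFibreHomeo p (t a)).symm ⟨f a, hft a⟩)) =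
      fun a => (hypersurfacePoint (regularToProjectiveSpace ℂ 2 p) (f a), t a) := by
    funext a
    exact coords_map_fiberι_cycFibreHomeo_symm p (t a) ⟨f a, hft a⟩
  rw [h]
  exact ((continuous_hypersurfacePoint _).comp hf).prodMk ht

end FibreEmbedding

end Literature.AlgebraicGeometry.HodgeTheory

end
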